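import Mathlib
import Literature.NumberTheory.GaloisRepresentations.FrobeniusDensity
import Literature.NumberTheory.Automorphic.ChebotarevArtinRepHolds
import Literature.NumberTheory.Automorphic.AutomorphicRepsGLSatakeFlathProofs
import Summits.Langlands.Langlands.Statement
import Summits.Langlands.Langlands.Theorems.ParityBlindBianchiArtinWeightRealisationLevelStubTwistDictionaryAt
import HarnessLib

/-!
# Stub `stub_adTraceTransfer` (S3ad) of the line `SketchIdeator2` for the crux
# `ParityBlindBianchi.ArtinWeightRealisationEven` (item stmt-Langlands-16619)

Chebotarev transfer of the adjoint trace identity.  Let `σ r : Γ_K → GL₂(ℚ̄_p)` be framed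
Galois representations of a number field `K` and `π` a cuspidal automorphic representation of
`GL₂(𝔸_K)` such that at all but finitely many finite places `w` (i) the arithmetic Frobenii of
`σ` above `w` have characteristic polynomial `arithFrobPolyOfSatake ι q_w 1 (c_w · α_w)` for a
Satake parameter `α_w` of `π_w` and a scalar `c_w ∈ ℂˣ`, and (ii) `π` is Satake–Frobenius
compatible with `r` at `w`.  Then `tr(r g)² · det σ(g) = tr(σ g)² · det r(g)` for **every**
`g ∈ Γ_K`.

Proof.  At an arithmetic Frobenius `Φ` above a good place `w`, Flath's uniqueness of Satake
parameters (`AutomorphicRepData.hasSatakeParamAt_unique_holds`) identifies the Satake parameters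
of (i) and (ii); writing `β = α.map (ι⁻¹ ∘ (·)⁻¹) = {b₁, b₂}` (`HasSatakeParamAt.card_eq`,
`Multiset.card_eq_two`) and `κ = ι⁻¹(c⁻¹)`, the two characteristic polynomials are
`(X - b₁)(X - b₂)` and `(X - κ b₁)(X - κ b₂)` (`arithFrobPolyOfSatake_one_eq_prod_map`,
`arithFrobPolyOfSatake_one_map_mul`), so `tr r(Φ) = b₁ + b₂`, `det r(Φ) = b₁ b₂`,
`tr σ(Φ) = κ (b₁ + b₂)`, `det σ(Φ) = κ² b₁ b₂` (`Matrix.charpoly_fin_two`) and the identity holds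
at `Φ`.  The identity set is closed (continuity of `g ↦ r g, σ g` as matrices, of `trace`, `det`;
`isClosed_eq`) and such Frobenii are dense in `Γ_K` (`absoluteGaloisGroup.frobenius_dense` fed
with `chebotarev_artinRep_holds`, the exceptional set being finite by `Filter.eventually_cofinite`),
whence the identity everywhere.  Same architecture as the landed `stub_frobeniusSignTransfer`.
-/

-- the line's namespace `Summit.Langlands.Langlands.…` (summit = problem = `Langlands`) repeats a component by design
set_option linter.dupNamespace false

namespace Summit.Langlands.Langlands.Theorems.ArtinWeightRealisationEven

open scoped MatrixGroups Matrix Polynomial NumberField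
open NumberField IsDedekindDomain Polynomial Field Filter
open Literature.NumberTheory.Automorphic Literature.NumberTheory.GaloisRepresentations

/-- For a `2 × 2` matrix `M` over a nontrivial commutative ring with characteristic polynomial
`(X - b₁)(X - b₂)`: `tr M = b₁ + b₂` and `det M = b₁ b₂` (compare the coefficients of
`X² - tr·X + det`, Mathlib `Matrix.charpoly_fin_two`). -/
theorem trace_det_of_charpoly_eq_X_sub_C_mul_X_sub_C {R : Type*} [CommRing R] [Nontrivial R]
    {M : Matrix (Fin 2) (Fin 2) R} {b₁ b₂ : R}
    (hM : M.charpoly = (X - C b₁) * (X - C b₂)) :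
    M.trace = b₁ + b₂ ∧ M.det = b₁ * b₂ := by
  have e : (X - C b₁) * (X - C b₂) = X ^ 2 - C (b₁ + b₂) * X + C (b₁ * b₂) := by
    simp only [map_add, map_mul]
    ring
  rw [Matrix.charpoly_fin_two, e] at hM
  have h0 := congrArg (fun q : R[X] => q.coeff 0) hM
  have h1 := congrArg (fun q : R[X] => q.coeff 1) hM
  simp at h0 h1
  exact ⟨by linear_combination -h1, h0⟩

/-- S3ad (Chebotarev transfer of the adjoint trace identity): if at all but finitely many places the Frobenius
polynomial of `σ` is the arithmetic-Frobenius polynomial of a non-zero scalar multiple of the Satake parameter of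
`π`, and `π` is Satake–Frobenius compatible with `r` there, then `tr(r g)² · det σ(g) = tr(σ g)² · det r(g)` for
every `g ∈ Γ_K` (Flath: one Satake parameter; at such a Frobenius the roots of `charpoly σ` are `κ` times those of
`charpoly r`; the identity is a closed condition and Frobenii at a cofinite set of places are dense,
`absoluteGaloisGroup.frobenius_dense`). -/
theorem stub_adTraceTransfer : ∀ (K : Type) [Field K] [NumberField K] (p : ℕ) [Fact p.Prime] (ι : PadicAlgCl p ≃+* ℂ) (σ r : FramedGaloisRep K (PadicAlgCl p) 2) (hcpt : isCompact_glFiniteIntegralLevel 2 K) (π : CuspidalAutomorphicRepData 2 K hcpt), (∀ᶠ w : HeightOneSpectrum (𝓞 K) in Filter.cofinite, (∃ α : Multiset ℂ, π.1.HasSatakeParamAt w α ∧ ∃ c : ℂ, c ≠ 0 ∧ σ.HasFrobCharpolyAt w (arithFrobPolyOfSatake ι w.residueCard 1 (α.map (c * ·)))) ∧ SatakeFrobCompatibleAt ι π.1 r w) → ∀ g : Field.absoluteGaloisGroup K, Matrix.trace ((r g : GL (Fin 2) (PadicAlgCl p)) : Matrix (Fin 2) (Fin 2) (PadicAlgCl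 p)) ^ 2 * Matrix.det ((σ g : GL (Fin 2) (PadicAlgCl p)) : Matrix (Fin 2) (Fin 2) (PadicAlgCl p)) = Matrix.trace ((σ g : GL (Fin 2) (PadicAlgCl p)) : Matrix (Fin 2) (Fin 2) (PadicAlgCl p)) ^ 2 * Matrix.det ((r g : GL (Fin 2) (PadicAlgCl p)) : Matrix (Fin 2) (Fin 2) (PadicAlgCl p)) := by
  intro K _ _ p _ ι σ r hcpt π hae
  classical
  -- the two matrix-valued maps and their continuity
  set fr : absoluteGaloisGroup K → Matrix (Fin 2) (Fin 2) (PadicAlgCl p) :=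
    fun g => ((r g : GL (Fin 2) (PadicAlgCl p)) : Matrix (Fin 2) (Fin 2) (PadicAlgCl p)) with hfr_def
  set fσ : absoluteGaloisGroup K → Matrix (Fin 2) (Fin 2) (PadicAlgCl p) :=
    fun g => ((σ g : GL (Fin 2) (PadicAlgCl p)) : Matrix (Fin 2) (Fin 2) (PadicAlgCl p)) with hfσ_def
  have hfr : Continuous fr := Units.continuous_val.comp (map_continuous r)
  have hfσ : Continuous fσ := Units.continuous_val.comp (map_continuous σ)
  -- the identity set `E` is closed
  set E : Set (absoluteGaloisGroup K) :=
    {g | (fr g).trace ^ 2 * (fσ g).det = (fσ g).trace ^ 2 * (fr g).det} with hE_def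
  have hE : IsClosed E :=
    isClosed_eq ((hfr.matrix_trace.pow 2).mul hfσ.matrix_det)
      ((hfσ.matrix_trace.pow 2).mul hfr.matrix_det)
  -- the finite exceptional set `S` and the dense set `D` of good Frobenii
  set S : Set (HeightOneSpectrum (𝓞 K)) :=
    {w | ¬ ((∃ α : Multiset ℂ, π.1.HasSatakeParamAt w α ∧ ∃ c : ℂ, c ≠ 0 ∧
        σ.HasFrobCharpolyAt w (arithFrobPolyOfSatake ι w.residueCard 1 (α.map (c * ·)))) ∧
      SatakeFrobCompatibleAt ι π.1 r w)} with hS_def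
  have hS : S.Finite := Filter.eventually_cofinite.mp hae
  set D : Set (absoluteGaloisGroup K) :=
    {φ | ∃ v ∉ S, ∃ 𝔓 ∈ v.primesAbove, IsArithFrobAt (𝓞 K) φ 𝔓} with hD_def
  have hD : Dense D := absoluteGaloisGroup.frobenius_dense chebotarev_artinRep_holds K S hS
  -- `D ⊆ E`: at a good Frobenius the roots of `charpoly σ` are `κ` times those of `charpoly r`
  have hDE : D ⊆ E := by
    rintro φ ⟨v, hvS, 𝔓, h𝔓, hφ⟩
    have hv : (∃ α : Multiset ℂ, π.1.HasSatakeParamAt v α ∧ ∃ c : ℂ, c ≠ 0 ∧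
        σ.HasFrobCharpolyAt v (arithFrobPolyOfSatake ι v.residueCard 1 (α.map (c * ·)))) ∧
        SatakeFrobCompatibleAt ι π.1 r v := Classical.not_not.mp hvS
    obtain ⟨⟨α, hα, c, -, hσP⟩, β, hβ, -, hrP⟩ := hv
    have hαβ : α = β := π.1.hasSatakeParamAt_unique_holds hα hβ
    subst hαβ
    have h2 : Multiset.card (α.map fun a ↦ ι.symm a⁻¹) = 2 := by
      rw [Multiset.card_map, hα.card_eq]
    obtain ⟨b₁, b₂, hb⟩ := Multiset.card_eq_two.mp h2
    have hr1 : (fr φ).charpoly = (X - C b₁) * (X - C b₂) := by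
      have h : (fr φ).charpoly = arithFrobPolyOfSatake ι v.residueCard 1 α := hrP 𝔓 h𝔓 φ hφ
      rw [h, ArtinWeightRealisationLevel.arithFrobPolyOfSatake_one_eq_prod_map, hb]
      simp
    have hσ1 : (fσ φ).charpoly = (X - C (ι.symm c⁻¹ * b₁)) * (X - C (ι.symm c⁻¹ * b₂)) := by
      have h : (fσ φ).charpoly = arithFrobPolyOfSatake ι v.residueCard 1 (α.map (c * ·)) :=
        hσP 𝔓 h𝔓 φ hφ
      rw [h, ArtinWeightRealisationLevel.arithFrobPolyOfSatake_one_map_mul, hb]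
      simp
    obtain ⟨htr, hdr⟩ := trace_det_of_charpoly_eq_X_sub_C_mul_X_sub_C (R := PadicAlgCl p) hr1
    obtain ⟨hts, hds⟩ := trace_det_of_charpoly_eq_X_sub_C_mul_X_sub_C (R := PadicAlgCl p) hσ1
    show (fr φ).trace ^ 2 * (fσ φ).det = (fσ φ).trace ^ 2 * (fr φ).det
    rw [htr, hdr, hts, hds]
    ring
  -- hence `E = Γ_K`
  have hEuniv : E = Set.univ := by
    rw [← hE.closure_eq]
    exact (hD.mono hDE).closure_eq
  intro g
  have hg : g ∈ E := by rw [hEuniv]; exact Set.mem_univ g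
  exact hg

end Summit.Langlands.Langlands.Theorems.ArtinWeightRealisationEven
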